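import Literature.AnabelianGeometry.EtaleTheta.LogDivisorModelTateTowerThetaTwistLevelAction

/-!
# [EtTh] Def. 3.3 (iii): «GRP₃′» acting on a Kummer level of the `Ÿ`-skeleton READ AT A QUOTIENT MODULUS `d ∣ M_n` — the 2b(ii)
# action knit in the form the 2c tower consumes (level `n` reads the index-`n` classes reduced mod `N_n = (n+1)!`; design (β), class (b))

S. Mochizuki, *The étale theta function …*, Publ. RIMS **45** (2009) [MochizukiEtTh2009], §1 p.13, Prop. 1.4 (ii) p.22, Def. 3.3
(i)(c)/(ii)/(iii) p.72–74 [cite: MochizukiEtTh2009, Def 3.3 p.73].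

CLASS (b) MODEL (abc-iut cell, layer L2; seat abc-iut-L2-t3 (gen 7); file 1 of the 2c-TOWER plan of record
`HOME/staging/L2/L2-t3/g7/2c/DESIGN-2c-ThetaTowerGrp3.md`; sequel of `…ThetaTwistLevelAction` (p485850) — UNTOUCHED, the case `d = M n`).
WHY A QUOTIENT MODULUS (abc-iut-L2-d2's finding for the chain-only tower, `…KummerTwistTower` p478618, applies verbatim): the tower law
`LogDivisorTower.act_closure_fn` wants `Δ_n = closure n = {right = 1, classes of index < n trivial}` to act TRIVIALLY at level `n`; `Δ_n`
contains elements with arbitrary index-`n` class, so level `n` must read the index-`n` classes REDUCED modulo `N_n = (n+1)! = M_{n−1}`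
(inside the compatible subgroup `k_n ≡ k_{n−1} (mod M_{n−1})`).  THIS FILE, for parameters `(n d : ℕ) (hd : d ∣ M n)` and
`π := ZMod.castHom hd (ZMod d)`, over the level `TateTowerThetaTwist.model μ_d` (`μ_d = Multiplicative (ZMod d)`):
* `levelKumMod : K₃ →* (ℤ/d)³` (`k ↦ π ∘ k_n`), `levelCharMod : C →* Aut μ_d` (`c ↦ (ζ ↦ ζ^{π(c_n)})`, abc-iut-L2-d2's `zmodChar d`);
* `kumActMod`, `cstTranslActMod` (`MonoidHom.noncommCoprod`; the constants and the sign-free translations `translAction 0` commute);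
* `map_shearClass` (`π` commutes with `σ_a`), `castHom_toAdd_act` (the index-`n` triple of `q·k` read mod `d`), `kumActMod_act` (the
  semidirect law on functions);
* **`levelActFnMod n d hd : Grp 3 thetaShear →* MulAut (Fn μ_d)`** (`SemidirectProduct.lift`), `_inl/_inr/_apply/_snd`, and
  **`levelActionMod n d hd : (model μ_d).GaloisAction (Grp 3 thetaShear)`** — EVERY LAW PROVED; `levelActFnMod_transl_theta` (the (β)
  deviation kernel-visible at every modulus), `levelActFnMod_kum_theta`.
DEVIATION OF RECORD (design (β), abc-iut-L2-lead gen 7 R922): the torsion sign `(−1)^a` of [EtTh] Prop. 1.4 (ii) (p.248: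
`Θ̈(q^{a/2} Ü) = (−1)^a q^{−a²/2} Ü^{−2a} Θ̈(Ü)`; `Θ̈(−Ü) = −Θ̈(Ü)`) is NOT carried by the level translations (`translAut 0`); print carries
signs inside `O^×_K̈ · η̈^Θ` (Prop. 1.4 (iii)) and the `(l·ℤ × μ₂)`-orbit classes `η̈^{Θ, l·ℤ×μ₂}` (Def. 2.7 p.267; Cor. 2.8 (i)); the tower's
uses (log-divisors, root law, temperedness, Kummer classes modulo torsion) are sign-blind.  HONEST LABEL: a combinatorial design model,
NOT the tempered fundamental group of a Tate curve; defs + theorems only, no Prop-valued fact, no instance, no notation, no sorry;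
nothing here bears on [IUTchIII] Cor. 3.12; no side taken; typed ≠ proved.
-/

noncomputable section

namespace Literature.AnabelianGeometry.EtaleTheta

open CategoryTheory

namespace LogDivisorModel

namespace TateTowerThetaTwist

open TateTowerTheta
open TateTowerKummerTwist (M one_lt_M Cst)
open TateTowerKummerTwistR (KumAdd Kum)
open TateTowerKummerTwistRShear (Grp act red thetaShear thetaShearMat)

variable (n d : ℕ) (hd : d ∣ M n)

/-! ## The index-`n` classes and the character, read modulo `d` -/

/-- The index-`n` class triple READ MODULO `d`: `k ↦ (k_n mod d) ∈ (ℤ/d)³`. [cite: MochizukiEtTh2009, Def 3.3 (ii) p.73] -/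
def levelKumMod : Kum 3 →* Multiplicative (Fin 3 → ZMod d) :=
  AddMonoidHom.toMultiplicative
    { toFun := fun k i => ZMod.castHom hd (ZMod d) (k n i)
      map_zero' := funext fun i => by rw [Pi.zero_apply, Pi.zero_apply, map_zero]; rfl
      map_add' := fun k k' => funext fun i => by rw [Pi.add_apply, Pi.add_apply, map_add]; rfl }

/-- `levelKumMod k = π ∘ k_n`. [cite: MochizukiEtTh2009, Def 3.3 (ii) p.73] -/
@[simp] theorem toAdd_levelKumMod (k : Kum 3) (i : Fin 3) :
    Multiplicative.toAdd (levelKumMod n d hd k) i = ZMod.castHom hd (ZMod d) (Multiplicative.toAdd k n i) := rfl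

/-- The cyclotomic character of the constants on `μ_d`: `c ↦ (ζ ↦ ζ^{π(c_n)})` (abc-iut-L2-d2's `zmodChar d`). [cite: MochizukiEtTh2009, §1 p.13] -/
def levelCharMod : Cst →* MulAut (Multiplicative (ZMod d)) :=
  (TateTowerTwist.zmodChar d).comp
    ((Units.map (ZMod.castHom hd (ZMod d)).toMonoidHom).comp (Pi.evalMonoidHom (fun m : ℕ => (ZMod (M m))ˣ) n))

/-- `levelCharMod c ζ = ζ^{π(c_n)}`. [cite: MochizukiEtTh2009, §1 p.13] -/
@[simp] theorem levelCharMod_apply (c : Cst) (z : Multiplicative (ZMod d)) :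
    levelCharMod n d hd c z = Multiplicative.ofAdd (ZMod.castHom hd (ZMod d) (c n : ZMod (M n)) * Multiplicative.toAdd z) := rfl

/-- The additive form of the character: multiplication by `π(c_n)`. [cite: MochizukiEtTh2009, §1 p.13] -/
def levelCharModAdd (c : Cst) : ZMod d ≃+ ZMod d := AddEquiv.toMultiplicative.symm (levelCharMod n d hd c)

/-- `levelCharModAdd c z = π(c_n) · z`. [cite: MochizukiEtTh2009, §1 p.13] -/
@[simp] theorem levelCharModAdd_apply (c : Cst) (z : ZMod d) :
    levelCharModAdd n d hd c z = ZMod.castHom hd (ZMod d) (c n : ZMod (M n)) * z := rfl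

/-- The multiplicative form of `levelCharModAdd` is `levelCharMod`. [cite: MochizukiEtTh2009, §1 p.13] -/
theorem toMultiplicative_levelCharModAdd (c : Cst) : AddEquiv.toMultiplicative (levelCharModAdd n d hd c) = levelCharMod n d hd c :=
  Equiv.apply_symm_apply _ _

/-! ## The pieces of the action on the functions of `model μ_d` -/

/-- The Kummer classes acting on the functions through their index-`n` triple mod `d`. [cite: MochizukiEtTh2009, Def 3.3 p.73] -/
def kumActMod : Kum 3 →* MulAut (Fn (Multiplicative (ZMod d))) := kummerAction.comp (levelKumMod n d hd)

/-- `kumActMod k = K_{π ∘ k_n}`. [cite: MochizukiEtTh2009, Def 3.3 p.73] -/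
@[simp] theorem kumActMod_apply (k : Kum 3) (x : Fn (Multiplicative (ZMod d))) :
    kumActMod n d hd k x = kummerAut (fun i => ZMod.castHom hd (ZMod d) (Multiplicative.toAdd k n i)) x := rfl

/-- The constants and the sign-free translations commute on functions. [cite: MochizukiEtTh2009, Def 3.3 p.73] -/
theorem commute_constAction_translAction_mod (c : Cst) (a : Multiplicative ℤ) :
    Commute (constAction (levelCharMod n d hd c)) (translAction (0 : ZMod d) a) := by
  rw [← toMultiplicative_levelCharModAdd]
  exact constAction_mul_translAction_zero (levelCharModAdd n d hd c) a

/-- `C × ℤ_γ` acting on the functions: `(c, a) ↦ C_{π χ_n(c)} ∘ T_a`. [cite: MochizukiEtTh2009, Def 3.3 p.73] -/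
def cstTranslActMod : Cst × Multiplicative ℤ →* MulAut (Fn (Multiplicative (ZMod d))) :=
  MonoidHom.noncommCoprod ((constAction (B := ZMod d)).comp (levelCharMod n d hd)) (translAction (0 : ZMod d))
    fun c a => commute_constAction_translAction_mod n d hd c a

/-- `cstTranslActMod (c, a) = C * T_a`. [cite: MochizukiEtTh2009, Def 3.3 p.73] -/
theorem cstTranslActMod_apply (q : Cst × Multiplicative ℤ) :
    cstTranslActMod n d hd q = constAction (levelCharMod n d hd q.1) * translAction (0 : ZMod d) q.2 := rfl

/-- **Reduction commutes with the shear of the classes** (`π` is additive). [cite: MochizukiEtTh2009, Prop 1.4 p.22] -/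
theorem map_shearClass {R S F : Type} [AddCommGroup R] [AddCommGroup S] [FunLike F R S] [AddMonoidHomClass F R S] (π : F)
    (a : ℤ) (κ : Fin 3 → R) (i : Fin 3) : π (shearClass a κ i) = shearClass a (fun j => π (κ j)) i := by
  fin_cases i <;> simp [shearClass, map_add, map_sub, map_neg, map_zsmul]

/-- The index-`n` triple of `q·k` read modulo `d`: `π(c_n) · σ_a (π ∘ k_n)`. [cite: MochizukiEtTh2009, Prop 1.4 p.22] -/
theorem castHom_toAdd_act (q : Cst × Multiplicative ℤ) (k : Kum 3) :
    (fun i => ZMod.castHom hd (ZMod d) (Multiplicative.toAdd (act 3 thetaShear q k) n i)) =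
      fun i => levelCharModAdd n d hd q.1 (shearClass (Multiplicative.toAdd q.2)
        (fun j => ZMod.castHom hd (ZMod d) (Multiplicative.toAdd k n j)) i) := by
  rw [toAdd_act_level n q k]
  funext i
  show ZMod.castHom hd (ZMod d) (levelCharAdd n q.1 (shearClass (Multiplicative.toAdd q.2) (Multiplicative.toAdd k n) i)) = _
  rw [levelCharAdd_apply, levelCharModAdd_apply, map_mul, map_shearClass]

/-- **The semidirect law on the functions of `model μ_d`**: `K_{π(q·k)_n} = (C_c T_a) K_{π k_n} (C_c T_a)⁻¹`.
[cite: MochizukiEtTh2009, Def 3.3 p.73] -/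
theorem kumActMod_act (q : Cst × Multiplicative ℤ) (k : Kum 3) :
    kumActMod n d hd (act 3 thetaShear q k) = cstTranslActMod n d hd q * kumActMod n d hd k * (cstTranslActMod n d hd q)⁻¹ := by
  refine MulEquiv.ext fun x => ?_
  rw [kumActMod_apply, castHom_toAdd_act, cstTranslActMod_apply]
  show _ = constAction (levelCharMod n d hd q.1) (translAction (0 : ZMod d) q.2 (kummerAut _
    ((translAction (0 : ZMod d) q.2).symm ((constAction (levelCharMod n d hd q.1)).symm x))))
  rw [← toMultiplicative_levelCharModAdd, constAction_apply, translAction_apply]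
  show _ = constAut (levelCharModAdd n d hd q.1) (translAut 0 (Multiplicative.toAdd q.2) (kummerAut _
    ((translAut 0 (Multiplicative.toAdd q.2)).symm ((constAut (levelCharModAdd n d hd q.1)).symm x))))
  rw [translAut_kummerAut_symm, constAut_kummerAut, MulEquiv.apply_symm_apply]
  rfl

/-! ## The knit at modulus `d` -/

/-- **«GRP₃′» acting on the functions of `model μ_d`** (`d ∣ M_n`; `d = N_n = (n+1)!` in the tower): `⟨k, (c, a)⟩ ↦ K_{π k_n} ∘ C_{π c_n} ∘ T_a`.
[cite: MochizukiEtTh2009, Def 3.3 p.73] -/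
def levelActFnMod : Grp 3 thetaShear →* MulAut (Fn (Multiplicative (ZMod d))) :=
  SemidirectProduct.lift (kumActMod n d hd) (cstTranslActMod n d hd) fun q => MonoidHom.ext fun k => by
    change kumActMod n d hd (act 3 thetaShear q k) = cstTranslActMod n d hd q * kumActMod n d hd k * (cstTranslActMod n d hd q)⁻¹
    exact kumActMod_act n d hd q k

/-- A pure Kummer element acts by `K_{π k_n}`. [cite: MochizukiEtTh2009, Def 3.3 p.73] -/
theorem levelActFnMod_inl (k : Kum 3) : levelActFnMod n d hd (SemidirectProduct.inl k) = kumActMod n d hd k := by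
  rw [levelActFnMod, SemidirectProduct.lift_inl]

/-- A pure `(c, a)` acts by `C ∘ T_a`. [cite: MochizukiEtTh2009, Def 3.3 p.73] -/
theorem levelActFnMod_inr (q : Cst × Multiplicative ℤ) : levelActFnMod n d hd (SemidirectProduct.inr q) = cstTranslActMod n d hd q := by
  rw [levelActFnMod, SemidirectProduct.lift_inr]

/-- `levelActFnMod g = K * (C * T)`. [cite: MochizukiEtTh2009, Def 3.3 p.73] -/
theorem levelActFnMod_apply (g : Grp 3 thetaShear) :
    levelActFnMod n d hd g =
      kumActMod n d hd g.left * (constAction (levelCharMod n d hd g.right.1) * translAction (0 : ZMod d) g.right.2) := rfl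

/-- The skeleton part of `g · x` is the sign-fixed shear by the translation component. [cite: MochizukiEtTh2009, Def 3.3 p.73] -/
theorem levelActFnMod_snd (g : Grp 3 thetaShear) (x : Fn (Multiplicative (ZMod d))) :
    (levelActFnMod n d hd g x).2 = shear₀Fn (Multiplicative.toAdd g.right.2) x.2 := rfl

/-- **The (β) deviation, kernel-visible at every modulus**: `T_a Θ̈ = 1 · ϖ̈^{−a²} Ü^{2a} Θ̈` (no root of unity). [cite: MochizukiEtTh2009, Prop 1.4 p.22] -/
theorem levelActFnMod_transl_theta (a : Multiplicative ℤ) :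
    levelActFnMod n d hd (SemidirectProduct.inr (1, a)) (theta (Multiplicative (ZMod d))) =
      (1, Multiplicative.ofAdd (((0 : ZMod 2), -(Multiplicative.toAdd a * Multiplicative.toAdd a),
        2 * Multiplicative.toAdd a, (1 : ℤ)) : Exp)) := by
  rw [levelActFnMod_inr, cstTranslActMod_apply, map_one, map_one, one_mul, translAction_apply, translAut_theta, smul_zero]
  rfl

/-- A Kummer element multiplies the root `Θ̈` by `ζ^{π k_n(Θ)}`. [cite: MochizukiEtTh2009, §1 p.13] -/
theorem levelActFnMod_kum_theta (k : Kum 3) :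
    levelActFnMod n d hd (SemidirectProduct.inl k) (theta (Multiplicative (ZMod d))) =
      (Multiplicative.ofAdd (ZMod.castHom hd (ZMod d) (Multiplicative.toAdd k n 2)), TateTowerTheta.theta) := by
  rw [levelActFnMod_inl, kumActMod_apply, kummerAut_theta]

/-- **Elements whose index-`n` classes vanish mod `d`, with trivial constant part and trivial translation, act trivially** — the
shape of the tower law `act_closure_fn` (at `d = N_n` every element of `Δ_n ∩ Compat` is such). [cite: MochizukiEtTh2009, Def 3.3 (i) p.72] -/
theorem levelActFnMod_eq_one {g : Grp 3 thetaShear} (hright : g.right = 1)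
    (hk : ∀ i, ZMod.castHom hd (ZMod d) (Multiplicative.toAdd g.left n i) = 0) : levelActFnMod n d hd g = 1 := by
  rw [levelActFnMod_apply, hright, Prod.fst_one, Prod.snd_one, map_one, map_one, map_one, mul_one, mul_one]
  refine MulEquiv.ext fun x => ?_
  rw [kumActMod_apply, MulAut.one_apply]
  have h0 : (fun i => ZMod.castHom hd (ZMod d) (Multiplicative.toAdd g.left n i)) = 0 := funext hk
  rw [h0, kummerAut_zero]
  rfl

variable [NeZero d]

/-- **The Galois action of «GRP₃′» on `model μ_d`** — functions by `levelActFnMod`, log-divisors / cusps / components by the translation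
quotient through the `Ÿ`-skeleton's `baseAction`; EVERY LAW PROVED. [cite: MochizukiEtTh2009, Def 3.3 p.73] -/
def levelActionMod : (model (Multiplicative (ZMod d))).GaloisAction (Grp 3 thetaShear) :=
  { (translGaloisAction (0 : ZMod d)).comap toTransl with
    actFn := levelActFnMod n d hd
    act_mem_logMero := fun _ _ _ => trivial
    act_mem_const := @fun g _ hf => ((translGaloisAction (0 : ZMod d)).comap toTransl).act_mem_const g hf
    act_mem_intConst := @fun g _ hf => ((translGaloisAction (0 : ZMod d)).comap toTransl).act_mem_intConst g hf
    divisor_act := fun g f => ((translGaloisAction (0 : ZMod d)).comap toTransl).divisor_act g f }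

/-- The action on functions is `levelActFnMod`. [cite: MochizukiEtTh2009, Def 3.3 p.73] -/
theorem levelActionMod_actFn : (levelActionMod n d hd).actFn = levelActFnMod n d hd := rfl

/-- The action on log-divisors is the skeleton's shift by the translation component (trivial when `g.right = 1` — the shape of
the tower law `act_closure_div`). [cite: MochizukiEtTh2009, Def 3.3 p.73] -/
theorem levelActionMod_actDIV (g : Grp 3 thetaShear) :
    (levelActionMod n d hd).actDIV g = TateTowerTheta.baseAction.actDIV g.right.2 := rfl

/-- `act_closure_div` shape: trivial translation component ⇒ trivial action on log-divisors. [cite: MochizukiEtTh2009, Def 3.3 (i) p.72] -/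
theorem levelActionMod_actDIV_eq_one {g : Grp 3 thetaShear} (hright : g.right = 1) : (levelActionMod n d hd).actDIV g = 1 := by
  rw [levelActionMod_actDIV, hright, Prod.snd_one, map_one]
  rfl

end TateTowerThetaTwist

end LogDivisorModel

end Literature.AnabelianGeometry.EtaleTheta

end
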